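import Mathlib.NumberTheory.ModularForms.EisensteinSeries.QExpansion
import Mathlib.NumberTheory.Bernoulli
import Mathlib.NumberTheory.Padics.PadicNumbers
import HarnessLib

/-!
# Deligne–Serre 1974, 6.9: the Eisenstein series `E_k`, `(ℓ - 1) ∣ k`, is `≡ 1 (mod ℓ)`

Deligne–Serre, *Formes modulaires de poids 1*, Ann. Sci. ÉNS (4) 7 (1974), 6.9 (p. 522):
"Pour `n` pair `> 2`, soit `E_n` la série d'Eisenstein de poids `n` sur `SL₂(ℤ)` normalisée
pour que son terme constant soit `1`. Si l'on choisit `n` divisible par `ℓ - 1`, le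
développement en série de `E_n` est `ℓ`-entier, et `E_n ≡ 1 (mod ℓ)`, cf. [25]" ([25] = Serre,
*Congruences et formes modulaires*, Sém. Bourbaki 416; also Swinnerton-Dyer, LNM 350, §3).

Everything here is PROVED from Mathlib: the `q`-expansion of the normalised level-one
Eisenstein series `ModularForm.E` (`EisensteinSeries.E_qExpansion_coeff`:
`a_0 = 1`, `a_m = -(2k / B_k) σ_{k-1}(m)` for `m ≥ 1`) and the von Staudt–Clausen theorem
(`Bernoulli.vonStaudt_clausen`: `B_{2k} + ∑_{(p-1) ∣ 2k} 1/p ∈ ℤ`), which gives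
`v_ℓ(B_k) = -1` when `(ℓ - 1) ∣ k`, hence `ℓ ∣ 2k / B_k` in `ℤ_{(ℓ)}`.

* `Literature.NumberTheory.EllipticCurves.ModularForms.DeligneSerre1974.padicValuation_bernoulli_eq` —
  `v_ℓ(B_k) = -1` (multiplicative notation: `Rat.padicValuation ℓ (bernoulli k) = exp 1`)
  for `k` even, `k ≠ 0`, `(ℓ - 1) ∣ k` (von Staudt–Clausen, easy half).
* `Literature.NumberTheory.EllipticCurves.ModularForms.DeligneSerre1974.eisenstein_qExpansion_congr_one` —
  **6.9**: for `k` even, `3 ≤ k`, `(ℓ - 1) ∣ k`, the `q`-expansion of `E_k` has constant term `1`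
  and every other coefficient is (the image in `ℂ` of) a rational number of `ℓ`-adic valuation
  `< 1`, i.e. an element of `ℓ ℤ_{(ℓ)}`.
* `Literature.NumberTheory.EllipticCurves.ModularForms.DeligneSerre1974.exists_eisenstein_weight` —
  for every prime `ℓ` there is such a weight (`k = 4 (ℓ - 1)`).

## References

* P. Deligne, J.-P. Serre, *Formes modulaires de poids 1*, Ann. Sci. ÉNS (4) 7 (1974), 6.9.
* J.-P. Serre, *Congruences et formes modulaires*, Sém. Bourbaki 416 (1972), §1.1 (b).
-/

noncomputable section

open scoped MatrixGroups ModularForm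

open WithZero ModularForm
open UpperHalfPlane hiding I

namespace Literature.NumberTheory.EllipticCurves.ModularForms.DeligneSerre1974

/-! ### `ℓ`-adic valuations of rationals -/

section Valuation

variable {ℓ : ℕ} [Fact ℓ.Prime]

/-- A rational number has `ℓ`-adic valuation `< 1` (i.e. lies in `ℓ ℤ_{(ℓ)}`) iff `ℓ` divides
its numerator. [folklore] -/
theorem padicValuation_lt_one_iff_dvd_num (r : ℚ) :
    Rat.padicValuation ℓ r < 1 ↔ (ℓ : ℤ) ∣ r.num := by
  have hden : Rat.padicValuation ℓ (r.den : ℚ) ≤ 1 := by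
    rw [← Int.cast_natCast, Rat.padicValuation_cast]
    exact Int.padicValuation_le_one ℓ _
  have hr : (r : ℚ) = r.num / r.den := (Rat.num_div_den r).symm
  have hden0 : (r.den : ℚ) ≠ 0 := Nat.cast_ne_zero.mpr r.den_nz
  have hvden0 : Rat.padicValuation ℓ (r.den : ℚ) ≠ 0 :=
    (Valuation.ne_zero_iff _).mpr hden0
  constructor
  · intro h
    by_contra hnd
    have h1 : Rat.padicValuation ℓ (r.num : ℚ) = 1 := by
      rw [Rat.padicValuation_cast, Int.padicValuation_eq_one_iff]
      exact hnd
    rw [hr, map_div₀, h1] at h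
    have h2 : (1 : ℤᵐ⁰) < Rat.padicValuation ℓ (r.den : ℚ) := by
      rwa [one_div, inv_lt_one₀ (zero_lt_iff.mpr hvden0)] at h
    exact absurd hden (not_le.mpr h2)
  · intro h
    have hcop : ¬ (ℓ : ℤ) ∣ (r.den : ℤ) := by
      intro h'
      have h1 : ℓ ∣ r.num.natAbs := Int.natCast_dvd.mp h
      have h2 : ℓ ∣ r.den := Int.natCast_dvd_natCast.mp h'
      have h3 : ℓ ∣ r.num.natAbs.gcd r.den := Nat.dvd_gcd h1 h2
      rw [r.reduced.gcd_eq_one] at h3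
      exact (Fact.out : ℓ.Prime).ne_one (Nat.dvd_one.mp h3)
    have h1 : Rat.padicValuation ℓ (r.num : ℚ) < 1 := by
      rw [Rat.padicValuation_cast, Int.padicValuation_lt_one_iff]
      exact h
    have h2 : Rat.padicValuation ℓ (r.den : ℚ) = 1 := by
      rw [← Int.cast_natCast, Rat.padicValuation_cast, Int.padicValuation_eq_one_iff]
      exact hcop
    rw [hr, map_div₀, h2, div_one]
    exact h1

/-- `v_ℓ(1/q) = 1` for a prime `q ≠ ℓ`. [folklore] -/
theorem padicValuation_one_div_prime {q : ℕ} (hq : q.Prime) (hqℓ : q ≠ ℓ) :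
    Rat.padicValuation ℓ ((1 : ℚ) / q) = 1 := by
  rw [map_div₀, map_one, one_div, inv_eq_one, ← Int.cast_natCast, Rat.padicValuation_cast,
    Int.padicValuation_eq_one_iff, Int.natCast_dvd_natCast, Nat.prime_dvd_prime_iff_eq Fact.out hq]
  exact fun h ↦ hqℓ h.symm

/-- `v_ℓ(1/ℓ) = ℓ` (multiplicatively: `exp 1`). [folklore] -/
theorem padicValuation_one_div_self : Rat.padicValuation ℓ ((1 : ℚ) / ℓ) = exp 1 := by
  rw [map_div₀, map_one, Rat.padicValuation_self, one_div, ← exp_neg, neg_neg]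

end Valuation

/-! ### von Staudt–Clausen: `v_ℓ(B_k) = -1` when `(ℓ - 1) ∣ k` -/

section Bernoulli

variable {ℓ : ℕ} [Fact ℓ.Prime]

/-- **von Staudt–Clausen, easy half.** For `k` even, `k ≠ 0` and `(ℓ - 1) ∣ k`, the Bernoulli
number `B_k` has `ℓ`-adic valuation exactly `-1`: `B_k ≡ -1/ℓ` modulo `ℤ_{(ℓ)}` (from Mathlib's
`Bernoulli.vonStaudt_clausen`, `B_{k} + ∑_{(p-1) ∣ k} 1/p ∈ ℤ`, in which `ℓ` occurs and all
other terms are `ℓ`-integral). [folklore] -/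
theorem padicValuation_bernoulli_eq {k : ℕ} (hk : Even k) (hk0 : k ≠ 0) (hℓk : (ℓ - 1) ∣ k) :
    Rat.padicValuation ℓ (bernoulli k) = exp 1 := by
  classical
  have hℓ : ℓ.Prime := Fact.out
  obtain ⟨k', rfl⟩ : ∃ k', k = 2 * k' := ⟨k / 2, by obtain ⟨a, rfl⟩ := hk; omega⟩
  have hk' : 0 < k' := by omega
  obtain ⟨T, hT⟩ := Bernoulli.vonStaudt_clausen k'
  set P : Finset ℕ := (Finset.range (2 * k' + 2)).filter fun p ↦ p.Prime ∧ (p - 1) ∣ 2 * k'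
    with hPdef
  have hℓP : ℓ ∈ P := by
    refine Finset.mem_filter.mpr ⟨Finset.mem_range.mpr ?_, hℓ, hℓk⟩
    have := Nat.le_of_dvd (by omega) hℓk
    have := hℓ.two_le
    omega
  -- `B_k = T - ∑_{q ≠ ℓ} 1/q - 1/ℓ`
  set S' : ℚ := ∑ q ∈ P.erase ℓ, (1 : ℚ) / q with hS'def
  have hsum : ∑ q ∈ P, (1 : ℚ) / q = 1 / ℓ + S' := by
    rw [hS'def, ← Finset.add_sum_erase P _ hℓP]
  have hB : bernoulli (2 * k') = (-(1 / ℓ)) + ((T : ℚ) - S') := by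
    have := hT
    rw [hsum] at this
    linear_combination -this
  -- valuations
  have hS' : Rat.padicValuation ℓ S' ≤ 1 := by
    refine Valuation.map_sum_le _ fun q hq ↦ ?_
    obtain ⟨hqℓ, hqP⟩ := Finset.mem_erase.mp hq
    exact (padicValuation_one_div_prime (Finset.mem_filter.mp hqP).2.1 hqℓ).le
  have hT' : Rat.padicValuation ℓ (T : ℚ) ≤ 1 := by
    rw [Rat.padicValuation_cast]
    exact Int.padicValuation_le_one ℓ T
  have h1 : Rat.padicValuation ℓ ((T : ℚ) - S') ≤ 1 := Valuation.map_sub_le _ hT' hS'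
  have h2 : Rat.padicValuation ℓ (-(1 / ℓ : ℚ)) = exp 1 := by
    rw [Valuation.map_neg, padicValuation_one_div_self]
  have hlt : Rat.padicValuation ℓ ((T : ℚ) - S') < Rat.padicValuation ℓ (-(1 / ℓ : ℚ)) := by
    rw [h2]
    refine lt_of_le_of_lt h1 ?_
    rw [← exp_zero, exp_lt_exp]
    exact zero_lt_one
  rw [hB, Valuation.map_add_eq_of_lt_left _ hlt, h2]

/-- For `k` even, `k ≠ 0`, `(ℓ - 1) ∣ k`, the normalising constant `2k / B_k` of the Eisenstein
series `E_k = 1 - (2k/B_k) ∑ σ_{k-1}(n) qⁿ` lies in `ℓ ℤ_{(ℓ)}` (valuation `≤ exp (-1) < 1`).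
[folklore] -/
theorem padicValuation_two_mul_div_bernoulli_lt_one {k : ℕ} (hk : Even k) (hk0 : k ≠ 0)
    (hℓk : (ℓ - 1) ∣ k) : Rat.padicValuation ℓ (2 * k / bernoulli k) < 1 := by
  rw [map_div₀, padicValuation_bernoulli_eq hk hk0 hℓk]
  have h2k : Rat.padicValuation ℓ (2 * k : ℚ) ≤ 1 := by
    have : ((2 * k : ℤ) : ℚ) = 2 * k := by push_cast; ring
    rw [← this, Rat.padicValuation_cast]
    exact Int.padicValuation_le_one ℓ _
  rw [div_eq_mul_inv, ← exp_neg]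
  calc Rat.padicValuation ℓ (2 * k : ℚ) * exp (-1) ≤ 1 * exp (-1) := mul_le_mul_left h2k _
    _ < 1 := by
      rw [one_mul, ← exp_zero, exp_lt_exp]
      norm_num

end Bernoulli

/-! ### 6.9: `E_k ≡ 1 (mod ℓ)` -/

section Eisenstein

variable {ℓ : ℕ} [Fact ℓ.Prime]

/-- **Deligne–Serre 1974, 6.9** (Serre, *Congruences et formes modulaires*, §1.1): let `ℓ` be a
prime and `k` an even weight, `k ≥ 3` (so `k ≥ 4`), divisible by `ℓ - 1`. Then the
`q`-expansion `∑ aₘ qᵐ` of the normalised level-one Eisenstein series `E_k` (Mathlib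
`ModularForm.E`, constant term `1`) is `ℓ`-integral and congruent to `1` modulo `ℓ`: `a_0 = 1`
and for `m ≠ 0`, `aₘ` is a rational number of `ℓ`-adic valuation `< 1` (an element of
`ℓ ℤ_{(ℓ)}`; indeed `aₘ = -(2k/B_k) σ_{k-1}(m)` and `v_ℓ(B_k) = -1` by von Staudt–Clausen).
[cite: DeligneSerreASENS1974, 6.9] -/
theorem eisenstein_qExpansion_congr_one {k : ℕ} (hk : 3 ≤ k) (hk2 : Even k)
    (hℓk : (ℓ - 1) ∣ k) :
    (qExpansion 1 (E hk)).coeff 0 = 1 ∧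
      ∀ m : ℕ, m ≠ 0 → ∃ r : ℚ, Rat.padicValuation ℓ r < 1 ∧
        (qExpansion 1 (E hk)).coeff m = (r : ℂ) := by
  refine ⟨EisensteinSeries.E_qExpansion_coeff_zero hk hk2, fun m hm ↦ ?_⟩
  refine ⟨-(2 * k / bernoulli k) * ArithmeticFunction.sigma (k - 1) m, ?_, ?_⟩
  · rw [Valuation.map_mul, Valuation.map_neg]
    have hσ : Rat.padicValuation ℓ (ArithmeticFunction.sigma (k - 1) m : ℚ) ≤ 1 := by
      rw [← Int.cast_natCast, Rat.padicValuation_cast]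
      exact Int.padicValuation_le_one ℓ _
    calc Rat.padicValuation ℓ (2 * k / bernoulli k) *
          Rat.padicValuation ℓ (ArithmeticFunction.sigma (k - 1) m : ℚ)
        ≤ Rat.padicValuation ℓ (2 * k / bernoulli k) * 1 := by gcongr
      _ < 1 := by
        rw [mul_one]
        exact padicValuation_two_mul_div_bernoulli_lt_one hk2 (by omega) hℓk
  · rw [EisensteinSeries.E_qExpansion_coeff hk hk2 m, if_neg hm]
    push_cast
    ring

omit [Fact ℓ.Prime] in
/-- For every prime `ℓ` there is an even weight `k ≥ 3` divisible by `ℓ - 1` (e.g.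
`k = 4 (ℓ - 1)`), to which `eisenstein_qExpansion_congr_one` applies. [folklore] -/
theorem exists_eisenstein_weight (hℓ : ℓ.Prime) : ∃ k : ℕ, 3 ≤ k ∧ Even k ∧ (ℓ - 1) ∣ k := by
  refine ⟨4 * (ℓ - 1), ?_, ⟨2 * (ℓ - 1), by ring⟩, Dvd.intro_left 4 rfl⟩
  have := hℓ.two_le
  omega

end Eisenstein

end Literature.NumberTheory.EllipticCurves.ModularForms.DeligneSerre1974
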